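import Summits.SmoothPoincare4.SmoothPoincare4.Theorems.SblfDescentRungOneHelperFoldNFPageHessianChart
import Summits.SmoothPoincare4.SmoothPoincare4.Theorems.SblfDescentRungOneHelperTimelikeNappeDichotomy
import Summits.SmoothPoincare4.SmoothPoincare4.Theorems.SblfDescentRungOneHelperTimelikePosScale
import Summits.SmoothPoincare4.SmoothPoincare4.Theorems.SblfDescentRungOneHelperTimelikeFlipPath
import HarnessLib

/-!
# The twisted alternative: the vanishing cycle returns reversed

Helper layer `helper_timelike_reversedLoop` of stub `helper_foldNF_timelike` (the untwistedness
of the round `1`-handle), line `Sketch`, crux `SblfDescent.RungOne`.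

(Crux item stmt-SmoothPoincare4-18531; skeleton `Cruxes/RungOne/Lines/Sketch.lean`.)

Let `f : X → S²` be a genus-one Lefschetz-free SBLF with equatorial round image, `v` the
torus-side pole, `e` the round circle by longitude, `ν₀` a tube about it, `W (t, x) = ν₀
(circlePt t, x)` and `g = ⟪v, f ∘ W⟫` the height family with page Hessians `H_t`.  Suppose
(the twisted alternative of `helper_timelike_dichotomy`) there is a continuous `H_t`-timelike
field `n` with `n (t + 1) = -n t`.  Then (`helper_timelike_reversedLoop`) the small spacelike
circle `ℓ (θ) = W (0, r (cos 2πθ b₁' + sin 2πθ b₂'))` of `H_0` is joined, through closed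
curves ON THE TORUS SIDE `{⟪v, f⟫ > 0}`, to its own reverse `ℓ (-θ)`.  Proof:
* a `2`-periodic adapted frame `Fr` (`Splitting.exists_periodic_adaptedFrame_of_timelike`,
  period `2`, field `n`): `H_t = 2c B (Fr t ·, Fr t ·)`; its monodromy `A = Fr 1 ∘ Fr 0⁻¹`
  lies in `O(B)`, has `det A > 0` (continuity of `det`), and REVERSES the time orientation
  (`A (Fr 0 n 0) = -Fr 1 n 1`, while the timelike curve `Fr t (n t)` keeps its nappe;
  O'Neill's timecone lemma);
* `A` is joined inside `O(B)` to the flip `b₂ ↦ -b₂, v₀ ↦ -v₀` (`helper_timelike_flipPath`);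
* transporting the `B`-unit spacelike circle by `Fr t⁻¹` along `t ∈ [0, 1]`, and then by the
  path in `O(B)` inside the slice `t = 1 ≡ 0`, gives the two families; all curves lie on the
  torus side for small radius because `H_t` is positive on them (`helper_timelike_posScale`).
This is the geometric form of "a twisted round handle reverses the vanishing cycle"
(Baykur–Kamada 2015, §2; Hayano 2011, §2.3).

## References

* R. İ. Baykur, S. Kamada, *Classification of broken Lefschetz fibrations with small fiber
  genera*, J. Math. Soc. Japan 67 (2015), §2. [BaykurKamada2015]
* K. Hayano, *On genus-1 simplified broken Lefschetz fibrations*, Algebr. Geom. Topol. 11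
  (2011), §2.3. [Hayano2011]
* B. O'Neill, *Semi-Riemannian Geometry* (1983), Ch. 5, Lemma 29; Ch. 9, Lemma 6. [ONeill1983]
-/

set_option linter.dupNamespace false

noncomputable section

open scoped Manifold ContDiff Topology RealInnerProductSpace
open Set Function Filter Metric Literature.Topology.FourManifolds
  Literature.AlgebraicTopology.SingularHomology

namespace Summit.SmoothPoincare4.SmoothPoincare4.Cruxes.RungOne.Sketch

/-- Local notation: `𝔼 n` is the model Euclidean space `EuclideanSpace ℝ (Fin n)`. -/
local notation "𝔼 " n:arg => EuclideanSpace ℝ (Fin n)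

/-- Local notation: `𝕊²`, the unit sphere of `ℝ³`. -/
local notation "𝕊²" => (Metric.sphere (0 : EuclideanSpace ℝ (Fin 3)) (1 : ℝ))

attribute [local instance] Literature.Topology.FourManifolds.fact_finrank_euclideanSpace_succ

/-- **A Lorentz frame for the pull-back of the standard index-one form** (full form).  For an
invertible `P : ℝ³ ≃L ℝ³`, the form `B (a, b) = (P a)₀(P b)₀ + (P a)₁(P b)₁ - (P a)₂(P b)₂` is
presented by the Lorentz frame `v₀ = P⁻¹ e₂`, `b₁ = P⁻¹ e₀`, `b₂ = P⁻¹ e₁`. [folklore] -/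
theorem lorentzFrame_of_equiv_full (P : 𝔼 3 ≃L[ℝ] 𝔼 3) {B : 𝔼 3 →L[ℝ] 𝔼 3 →L[ℝ] ℝ}
    (hB : ∀ a b : 𝔼 3, B a b = (P a) 0 * (P b) 0 + (P a) 1 * (P b) 1 - (P a) 2 * (P b) 2) :
    B (P.symm (EuclideanSpace.single 2 1)) (P.symm (EuclideanSpace.single 2 1)) = -1 ∧
    B (P.symm (EuclideanSpace.single 0 1)) (P.symm (EuclideanSpace.single 0 1)) = 1 ∧
    B (P.symm (EuclideanSpace.single 1 1)) (P.symm (EuclideanSpace.single 1 1)) = 1 ∧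
    B (P.symm (EuclideanSpace.single 2 1)) (P.symm (EuclideanSpace.single 0 1)) = 0 ∧
    B (P.symm (EuclideanSpace.single 2 1)) (P.symm (EuclideanSpace.single 1 1)) = 0 ∧
    B (P.symm (EuclideanSpace.single 0 1)) (P.symm (EuclideanSpace.single 1 1)) = 0 ∧
    ∀ x : 𝔼 3, x = (-B (P.symm (EuclideanSpace.single 2 1)) x) • P.symm (EuclideanSpace.single 2 1) +
      B (P.symm (EuclideanSpace.single 0 1)) x • P.symm (EuclideanSpace.single 0 1) +
      B (P.symm (EuclideanSpace.single 1 1)) x • P.symm (EuclideanSpace.single 1 1) := by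
  -- adapted from the sibling layer `helper_foldNF_periodicFrame_of_timelike`
  simp only [hB, ContinuousLinearEquiv.apply_symm_apply]
  refine ⟨by simp, by simp, by simp, by simp, by simp, by simp, fun x => ?_⟩
  apply P.injective
  simp only [map_add, map_smul, ContinuousLinearEquiv.apply_symm_apply]
  ext i
  fin_cases i <;> simp

set_option maxHeartbeats 800000 in
/-- **The twisted alternative reverses the vanishing cycle.**  For a genus-one Lefschetz-free
SBLF with equatorial round image, torus-side pole `v`, round circle `e` and tube `ν₀`, with
`g (t, x) = ⟪v, f (ν₀ (circlePt t, x))⟫` and `H_t = ∂ₓ∂ₓ g (t, 0)`: if a continuous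
`H_t`-timelike field `n` with `n (t + 1) = -n t` exists, then there are `H_0`-orthogonal
`H_0`-spacelike `b₁, b₂` and `r₀ > 0` such that for every `0 < r ≤ r₀` the circle
`θ ↦ ν₀ (circlePt 0, r (cos 2πθ b₁ + sin 2πθ b₂))` is joined to its reverse through two
continuous families of closed curves lying on the torus side `{⟪v, f⟫ > 0}`.
[cite: BaykurKamada2015, §2] [cite: Hayano2011, §2.3] [cite: ONeill1983, Ch. 5, Lemma 29; Ch. 9, Lemma 6] -/
theorem helper_timelike_reversedLoop : ∀ (X : Type) [TopologicalSpace X] [T2Space X] [SecondCountableTopology X] [CompactSpace X] [ChartedSpace (𝔼 4) X] [IsManifold (𝓡 4) ∞ X] (o : SmoothOrientation (𝓡 4) X) (f : X → 𝕊²), IsSimplifiedBrokenLefschetzFibration o f ∅ 0 → f '' ({p : X | ¬ Surjective (mfderiv (𝓡 4) (𝓡 2) f p)} \ (↑(∅ : Finset X) : Set X)) = sphereEquator 1 → ∀ (v : 𝕊²), (v : 𝔼 3) 0 = 0 → (v : 𝔼 3) 1 = 0 → (∀ y : 𝕊², ⟪(y : 𝔼 3), (v : 𝔼 3)⟫ <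 0 → (∀ q, f q = y → Surjective (mfderiv (𝓡 4) (𝓡 2) f q)) ∧ Nonempty ((Fin (2 * 0) → ℤ) ≃ₗ[ℤ] singularHomology ℤ ℤ ↥(f ⁻¹' {y}) 1)) → (∀ y : 𝕊², ⟪(y : 𝔼 3), ((-v : 𝕊²) : 𝔼 3)⟫ < 0 → (∀ q, f q = y → Surjective (mfderiv (𝓡 4) (𝓡 2) f q)) ∧ Nonempty ((Fin (2 * (0 + 1)) → ℤ) ≃ₗ[ℤ] singularHomology ℤ ℤ ↥(f ⁻¹' {y}) 1)) → ∀ (e : Metric.sphere (0 : 𝔼 2) 1 → X) (ν₀ : CircleNbhd (𝓡 4) e), Set.range e = {p : X | ¬ Surjective (mfderiv (𝓡 4) (𝓡 2) f p)} \ (↑(∅ : Finset X) : Set X) → (∀ u, f (e u) = sphereInclusion 1 2 one_le_two u) → ∀ (n : ℝ → 𝔼 3), Continuous n → (∀ t : ℝ, n (t + 1) = -n t) → (∀ t : ℝ, fderiv ℝ (fderiv ℝ (fun q : ℝ × 𝔼 3 => SphereHeight.height (v : 𝔼 3) (f (ν₀.toFun (circlePt q.1, q.2))))) (t, 0) ((0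 : ℝ), n t) ((0 : ℝ), n t) < 0) → ∃ (b₁ b₂ : 𝔼 3) (r₀ : ℝ), 0 < fderiv ℝ (fderiv ℝ (fun q : ℝ × 𝔼 3 => SphereHeight.height (v : 𝔼 3) (f (ν₀.toFun (circlePt q.1, q.2))))) ((0 : ℝ), (0 : 𝔼 3)) ((0 : ℝ), b₁) ((0 : ℝ), b₁) ∧ 0 < fderiv ℝ (fderiv ℝ (fun q : ℝ × 𝔼 3 => SphereHeight.height (v : 𝔼 3) (f (ν₀.toFun (circlePt q.1, q.2))))) ((0 : ℝ), (0 : 𝔼 3)) ((0 : ℝ), b₂) ((0 : ℝ), b₂) ∧ fderiv ℝ (fderiv ℝ (fun q : ℝ × 𝔼 3 => SphereHeight.height (v : 𝔼 3) (f (ν₀.toFun (circlePt q.1, q.2))))) ((0 : ℝ), (0 : 𝔼 3)) ((0 : ℝ), b₁) ((0 : ℝ), b₂) = 0 ∧ 0 < r₀ ∧ ∀ r : ℝ, 0 < r → r ≤ r₀ → ∃ (L₁ L₂ : ℝ × ℝ → X), Continuous L₁ ∧ Continuous L₂ ∧ (∀ s θ : ℝ, L₁ (s, θ + 1) = L₁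 (s, θ)) ∧ (∀ s θ : ℝ, L₂ (s, θ + 1) = L₂ (s, θ)) ∧ (∀ θ : ℝ, L₁ (1, θ) = L₂ (1, θ)) ∧ (∀ θ : ℝ, L₂ (0, θ) = L₁ (0, -θ)) ∧ (∀ s θ : ℝ, 0 < SphereHeight.height (v : 𝔼 3) (f (L₁ (s, θ)))) ∧ (∀ s θ : ℝ, 0 < SphereHeight.height (v : 𝔼 3) (f (L₂ (s, θ)))) ∧ (∀ θ : ℝ, L₁ (0, θ) = ν₀.toFun (circlePt 0, r • (Real.cos (2 * Real.pi * θ) • b₁ + Real.sin (2 * Real.pi * θ) • b₂))) := by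
  intro X _ _ _ _ _ _ o f hf hround v hv0 hv1 hlo hhi e ν₀ hrange hfe n hn hnT hnneg
  have hAt := helper_foldNF_pageHessianAt X o f hf hround v hv0 hv1 hlo hhi e ν₀ hrange hfe
  obtain ⟨-, -, -, hgs, hg0, hg1, -⟩ := helper_foldNF_family X o f hf hround v hv0 hv1 e ν₀ hrange hfe
  set g : ℝ × 𝔼 3 → ℝ := fun q => SphereHeight.height (v : 𝔼 3) (f (ν₀.toFun (circlePt q.1, q.2)))
    with hgdef
  set W : ℝ × 𝔼 3 → X := fun q => ν₀.toFun (circlePt q.1, q.2) with hWdef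
  have hWc : Continuous W :=
    ν₀.isSmoothEmbedding.contMDiff.continuous.comp
      ((continuous_circlePt.comp continuous_fst).prodMk continuous_snd)
  have hgW : ∀ q, g q = SphereHeight.height (v : 𝔼 3) (f (W q)) := fun q => rfl
  have hW1 : ∀ (t : ℝ) (x : 𝔼 3), W (t + 1, x) = W (t, x) := fun t x => by
    simp [hWdef, circlePt_add_one]
  have hgT : ∀ (t : ℝ) (u : 𝔼 3), g (t + 1, u) = g (t, u) := fun t u => by
    simp [hgdef, circlePt_add_one]
  have hgT2 : ∀ (t : ℝ) (u : 𝔼 3), g (t + 2, u) = g (t, u) := fun t u => by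
    rw [show t + 2 = t + 1 + 1 by ring, hgT, hgT]
  -- the page Hessians as bilinear maps; nondegeneracy
  set Hf : ℝ → 𝔼 3 →L[ℝ] 𝔼 3 →L[ℝ] ℝ := fun t =>
    (fderiv ℝ (fderiv ℝ g) (t, 0)).bilinearComp (ContinuousLinearMap.inr ℝ ℝ (𝔼 3))
      (ContinuousLinearMap.inr ℝ ℝ (𝔼 3)) with hHf
  have hHap : ∀ (t : ℝ) (a b : 𝔼 3), Hf t a b = fderiv ℝ (fderiv ℝ g) (t, 0) ((0 : ℝ), a) ((0 : ℝ), b) :=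
    fun t a b => by simp [hHf]
  have hH1 : ∀ t, Hf (t + 1) = Hf t := fun t => by
    ext a b
    rw [hHap, hHap, Splitting.fderiv_fderiv_apply_add_of_periodic hgT]
  have hnd : ∀ (t : ℝ) (a : 𝔼 3),
      (∀ b, fderiv ℝ (fderiv ℝ g) (t, 0) ((0 : ℝ), a) ((0 : ℝ), b) = 0) → a = 0 := by
    intro t a ha
    obtain ⟨c, P, hc, hP, hH, -⟩ := hAt t
    set Pe : 𝔼 3 ≃L[ℝ] 𝔼 3 := (LinearEquiv.ofInjectiveEndo P.toLinearMap hP).toContinuousLinearEquiv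
    have hPe' : ∀ a, Pe a = P a := fun a => rfl
    have hco : ∀ y : 𝔼 3, (P a) 0 * y 0 + (P a) 1 * y 1 - (P a) 2 * y 2 = 0 := fun y => by
      have h := ha (Pe.symm y)
      rw [hH, ← hPe' (Pe.symm y), ContinuousLinearEquiv.apply_symm_apply] at h
      simpa [hc] using h
    have h0 := hco (EuclideanSpace.single 0 1)
    have h1 := hco (EuclideanSpace.single 1 1)
    have h2 := hco (EuclideanSpace.single 2 1)
    simp at h0 h1 h2
    have hz : Pe a = 0 := by
      rw [hPe']
      ext i; fin_cases i
      · simpa using h0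
      · simpa using h1
      · simpa using h2
    simpa using congrArg Pe.symm hz
  -- the reference form at `t = 0`: `H_0 = (2c) · B` with a Lorentz frame
  obtain ⟨c, P, -, hPinj, hH0, hc0⟩ := hAt 0
  have hc : 0 < c := hc0 rfl
  set Pe : 𝔼 3 ≃L[ℝ] 𝔼 3 := (LinearEquiv.ofInjectiveEndo P.toLinearMap hPinj).toContinuousLinearEquiv
    with hPe
  have hPe' : ∀ a, Pe a = P a := fun a => rfl
  obtain ⟨Bq, hBq⟩ := exists_clm_sliceForm
  set B : 𝔼 3 →L[ℝ] 𝔼 3 →L[ℝ] ℝ := Bq.bilinearComp (Pe : 𝔼 3 →L[ℝ] 𝔼 3) (Pe : 𝔼 3 →L[ℝ] 𝔼 3)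
    with hBdef
  have hB : ∀ a b : 𝔼 3, B a b = (Pe a) 0 * (Pe b) 0 + (Pe a) 1 * (Pe b) 1 - (Pe a) 2 * (Pe b) 2 :=
    fun a b => by simp [hBdef, hBq]
  have hBsymm : ∀ a b, B a b = B b a := fun a b => by rw [hB, hB]; ring
  have hHB : ∀ a b : 𝔼 3, fderiv ℝ (fderiv ℝ g) ((0 : ℝ), (0 : 𝔼 3)) ((0 : ℝ), a) ((0 : ℝ), b) =
      (2 * c) * B a b := fun a b => by
    rw [hB, hPe', hPe', hH0 a b]; ring
  have h2c : (0 : ℝ) < 2 * c := by positivity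
  obtain ⟨hv, h1, h2, h01, h02, h12, hexp⟩ := lorentzFrame_of_equiv_full Pe hB
  set v₀ : 𝔼 3 := Pe.symm (EuclideanSpace.single 2 1) with hv₀
  set b₁ : 𝔼 3 := Pe.symm (EuclideanSpace.single 0 1) with hb₁
  set b₂ : 𝔼 3 := Pe.symm (EuclideanSpace.single 1 1) with hb₂
  have hvneg : B v₀ v₀ < 0 := by rw [hv]; norm_num
  -- Step A: a `2`-periodic adapted frame along the `2`-periodic field `n`
  have hn2 : ∀ t, n (t + 2) = n t := fun t => by
    rw [show t + 2 = t + 1 + 1 by ring, hnT, hnT, neg_neg]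
  obtain ⟨Fr, Frinv, hFr, hFrinv, hFrT, hFrinvT, hri, hli, had⟩ :=
    Splitting.exists_periodic_adaptedFrame_of_timelike hgs two_pos hgT2 hnd hBsymm h2c hHB hv h1 h2
      h01 h02 h12 hexp hn hn2 hnneg
  have had' : ∀ (t : ℝ) (a b : 𝔼 3), Hf t a b = (2 * c) * B (Fr t a) (Fr t b) := fun t a b => by
    rw [hHap]; exact had t a b
  have hBFrinv : ∀ (t : ℝ) (y : 𝔼 3), Hf t (Frinv t y) (Frinv t y) = (2 * c) * B y y :=
    fun t y => by rw [had', hri]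
  -- Step B: the monodromy `A = Fr 1 ∘ Frinv 0`
  set A : 𝔼 3 →L[ℝ] 𝔼 3 := (Fr 1).comp (Frinv 0) with hAdef
  have hAO : ∀ x y, B (A x) (A y) = B x y := fun x y => by
    have e1 := had' 1 (Frinv 0 x) (Frinv 0 y)
    have e0 := had' 0 (Frinv 0 x) (Frinv 0 y)
    rw [hri, hri] at e0
    have hH10 : Hf 1 = Hf 0 := by have := hH1 0; rwa [zero_add] at this
    rw [hH10, e0] at e1
    change B (Fr 1 (Frinv 0 x)) (Fr 1 (Frinv 0 y)) = B x y
    have := mul_left_cancel₀ h2c.ne' e1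
    exact this.symm
  -- (B1) `A` reverses the time orientation
  set m : ℝ → 𝔼 3 := fun t => Fr t (n t) with hmdef
  have hmc : Continuous m := hFr.continuous.clm_apply hn
  have hmneg : ∀ t, B (m t) (m t) < 0 := fun t => by
    have h := hnneg t
    rw [← hHap, had'] at h
    by_contra hle
    push Not at hle
    have := mul_nonneg h2c.le hle
    linarith
  have hm0 : ∀ t, B (m t) v₀ ≠ 0 := fun t => lorentz_apply_ne_zero hexp (hmneg t) hvneg
  have hsign : 0 < B (m 0) v₀ * B (m 1) v₀ := by
    by_contra hle
    push Not at hle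
    have hcont' : Continuous fun t => B (m t) v₀ := (B.flip v₀).continuous.comp hmc
    have hcont : ContinuousOn (fun t => B (m t) v₀) (Icc 0 1) := hcont'.continuousOn
    rcases mul_nonpos_iff.1 hle with ⟨ha, hb⟩ | ⟨ha, hb⟩
    · obtain ⟨t, -, ht⟩ := intermediate_value_Icc' zero_le_one hcont ⟨hb, ha⟩
      exact hm0 t ht
    · obtain ⟨t, -, ht⟩ := intermediate_value_Icc zero_le_one hcont ⟨ha, hb⟩
      exact hm0 t ht
  have hn01 : n 0 = -n 1 := by have := hnT 0; rw [zero_add] at this; rw [this, neg_neg]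
  have hAm : A (m 0) = -m 1 := by
    change Fr 1 (Frinv 0 (Fr 0 (n 0))) = -(Fr 1 (n 1))
    rw [hli, hn01, map_neg]
  have hArev : 0 < B (A v₀) v₀ := by
    have hRO' : ∀ x y, B ((-A) x) ((-A) y) = B x y := fun x y => by
      change B (-(A x)) (-(A y)) = B x y
      rw [map_neg, map_neg, neg_apply, neg_neg, hAO]
    have hRx : 0 < B v₀ ((-A) (m 0)) * B v₀ (m 0) := by
      change 0 < B v₀ (-(A (m 0))) * B v₀ (m 0)
      rw [hAm, neg_neg, hBsymm v₀ (m 1), hBsymm v₀ (m 0), mul_comm]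
      exact hsign
    have h := Splitting.neg_of_timeconePreserving hBsymm hv hexp hRO' (hmneg 0) hRx
    change B (-(A v₀)) v₀ < 0 at h
    rw [map_neg, neg_apply] at h
    linarith
  -- (B2) `det A > 0`
  have hdetA : 0 < A.det := by
    have hid : (Fr 0).comp (Frinv 0) = ContinuousLinearMap.id ℝ (𝔼 3) :=
      ContinuousLinearMap.ext fun x => by simp [hri]
    have h0 : 0 < ((Fr 0).comp (Frinv 0)).det := by
      rw [hid]
      unfold ContinuousLinearMap.det
      rw [ContinuousLinearMap.coe_id, LinearMap.det_id]
      exact one_pos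
    exact IndexOneForm.det_pos_of_continuousOn (P := fun s => (Fr s).comp (Frinv 0))
      (Pinv := fun s => (Fr 0).comp (Frinv s)) zero_le_one
      ((hFr.continuous.clm_comp continuous_const).continuousOn)
      (fun s _ x => by change Fr s (Frinv 0 (Fr 0 (Frinv s x))) = x; rw [hli, hri]) h0
  -- (B3) the path from the flip to `A` inside `O(B)`
  obtain ⟨Ai, hAic, hAiO, hAi0, hAi1, hAib₁, hAib₂, hAAi⟩ :=
    helper_timelike_flipPath B hBsymm v₀ b₁ b₂ hv h1 h2 h01 h02 h12 hexp A hAO hdetA hArev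
  have hclamp : ∀ s : ℝ, ∃ s' ∈ Icc (0 : ℝ) 1, Ai s = Ai s' := fun s => by
    rcases le_total s 0 with hs | hs
    · exact ⟨0, ⟨le_rfl, zero_le_one⟩, hAi0 s hs⟩
    rcases le_total s 1 with hs' | hs'
    · exact ⟨s, ⟨hs, hs'⟩, rfl⟩
    · exact ⟨1, ⟨zero_le_one, le_rfl⟩, hAi1 s hs'⟩
  -- Step C: the `B`-unit spacelike circle `u` and the positivity radius
  set u : ℝ → 𝔼 3 := fun θ => Real.cos (2 * Real.pi * θ) • b₁ + Real.sin (2 * Real.pi * θ) • b₂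
    with hudef
  have huc : Continuous u := by
    have hc : Continuous fun θ : ℝ => Real.cos (2 * Real.pi * θ) := by fun_prop
    have hs : Continuous fun θ : ℝ => Real.sin (2 * Real.pi * θ) := by fun_prop
    exact (hc.smul continuous_const).add (hs.smul continuous_const)
  have hu1 : ∀ θ, u (θ + 1) = u θ := fun θ => by
    simp only [hudef, mul_add, mul_one, Real.cos_add_two_pi, Real.sin_add_two_pi]
  have hufr : ∀ θ, u θ = u (Int.fract θ) := fun θ => by
    have hper : Function.Periodic u 1 := hu1
    have h := hper.zsmul ⌊θ⌋ (Int.fract θ)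
    rw [zsmul_one, Int.fract_add_floor] at h
    exact h
  have h21 : B b₂ b₁ = 0 := by rw [hBsymm, h12]
  have hBu : ∀ θ, B (u θ) (u θ) = 1 := fun θ => by
    simp only [hudef, map_add, map_smul, add_apply, smul_apply, smul_eq_mul, h1, h2, h12, h21]
    nlinarith [Real.cos_sq_add_sin_sq (2 * Real.pi * θ)]
  -- compact parameter sets of spacelike directions
  set K₁ : Set (ℝ × 𝔼 3) :=
    (fun p : ℝ × ℝ => ((p.1, Frinv p.1 (u p.2)) : ℝ × 𝔼 3)) '' (Icc (0 : ℝ) 2 ×ˢ Icc (0 : ℝ) 1)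
    with hK₁def
  set K₂ : Set (ℝ × 𝔼 3) :=
    (fun p : ℝ × ℝ => (((0 : ℝ), Frinv 0 (Ai p.1 (u p.2))) : ℝ × 𝔼 3)) '' (Icc (0 : ℝ) 1 ×ˢ Icc (0 : ℝ) 1)
    with hK₂def
  have hK₁ : IsCompact K₁ :=
    (isCompact_Icc.prod isCompact_Icc).image
      (continuous_fst.prodMk ((hFrinv.continuous.comp continuous_fst).clm_apply
        (huc.comp continuous_snd)))
  have hK₂ : IsCompact K₂ :=
    (isCompact_Icc.prod isCompact_Icc).image
      (continuous_const.prodMk ((Frinv 0).continuous.comp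
        ((hAic.comp continuous_fst).clm_apply (huc.comp continuous_snd))))
  have hKpos : ∀ q ∈ K₁ ∪ K₂, 0 < fderiv ℝ (fderiv ℝ g) (q.1, 0) ((0 : ℝ), q.2) ((0 : ℝ), q.2) := by
    rintro q (⟨p, -, rfl⟩ | ⟨p, -, rfl⟩)
    · change 0 < fderiv ℝ (fderiv ℝ g) (p.1, 0) ((0 : ℝ), Frinv p.1 (u p.2)) ((0 : ℝ), Frinv p.1 (u p.2))
      rw [← hHap, hBFrinv, hBu, mul_one]
      exact h2c
    · change 0 < fderiv ℝ (fderiv ℝ g) (0, 0) ((0 : ℝ), Frinv 0 (Ai p.1 (u p.2)))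
        ((0 : ℝ), Frinv 0 (Ai p.1 (u p.2)))
      rw [← hHap, hBFrinv, hAiO, hBu, mul_one]
      exact h2c
  obtain ⟨r₀, hr₀, hpos⟩ :=
    helper_timelike_posScale (𝔼 3) g hgs hg0 hg1 (K₁ ∪ K₂) (hK₁.union hK₂) hKpos
  -- the output: spacelike pair `Frinv 0 b₁, Frinv 0 b₂` and the radius `r₀`
  refine ⟨Frinv 0 b₁, Frinv 0 b₂, r₀, ?_, ?_, ?_, hr₀, fun r hr hrr => ?_⟩
  · rw [← hHap, had', hri, h1, mul_one]; exact h2c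
  · rw [← hHap, had', hri, h2, mul_one]; exact h2c
  · rw [← hHap, had', hri, hri, h12, mul_zero]
  -- periodic reductions
  have hgper : ∀ (s : ℝ) (x : 𝔼 3), g (s, x) = g (toIcoMod two_pos 0 s, x) := fun s x => by
    have hper : Function.Periodic (fun t => g (t, x)) 2 := fun t => hgT2 t x
    have h := hper.zsmul (toIcoDiv two_pos 0 s) (toIcoMod two_pos 0 s)
    rw [toIcoMod_add_toIcoDiv_zsmul] at h
    exact h
  have hFrinvper : ∀ s : ℝ, Frinv s = Frinv (toIcoMod two_pos 0 s) := fun s => by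
    have hper : Function.Periodic Frinv 2 := hFrinvT
    have h := hper.zsmul (toIcoDiv two_pos 0 s) (toIcoMod two_pos 0 s)
    rw [toIcoMod_add_toIcoDiv_zsmul] at h
    exact h
  have hmod : ∀ s : ℝ, toIcoMod two_pos 0 s ∈ Icc (0 : ℝ) 2 := fun s => by
    have h := toIcoMod_mem_Ico two_pos (0 : ℝ) s
    rw [zero_add] at h
    exact Ico_subset_Icc_self h
  have hfrI : ∀ θ : ℝ, Int.fract θ ∈ Icc (0 : ℝ) 1 := fun θ =>
    ⟨Int.fract_nonneg θ, (Int.fract_lt_one θ).le⟩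
  -- the two families
  set L₁ : ℝ × ℝ → X := fun p => W (p.1, r • Frinv p.1 (u p.2)) with hL₁
  set L₂ : ℝ × ℝ → X := fun p => W (0, r • Frinv 0 (Ai p.1 (u p.2))) with hL₂
  refine ⟨L₁, L₂, ?_, ?_, fun s θ => ?_, fun s θ => ?_, fun θ => ?_, fun θ => ?_,
    fun s θ => ?_, fun s θ => ?_, fun θ => ?_⟩
  · exact hWc.comp (continuous_fst.prodMk (((hFrinv.continuous.comp continuous_fst).clm_apply
      (huc.comp continuous_snd)).const_smul r))
  · exact hWc.comp (continuous_const.prodMk (((Frinv 0).continuous.comp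
      ((hAic.comp continuous_fst).clm_apply (huc.comp continuous_snd))).const_smul r))
  · change W (s, r • Frinv s (u (θ + 1))) = W (s, r • Frinv s (u θ))
    rw [hu1]
  · change W (0, r • Frinv 0 (Ai s (u (θ + 1)))) = W (0, r • Frinv 0 (Ai s (u θ)))
    rw [hu1]
  · -- `L₁ (1, θ) = L₂ (1, θ)`: `Frinv 0 ∘ Ai 1 = Frinv 1` and `W (1, ·) = W (0, ·)`
    change W (1, r • Frinv 1 (u θ)) = W (0, r • Frinv 0 (Ai 1 (u θ)))
    have hz : Frinv 0 (Ai 1 (u θ)) = Frinv 1 (u θ) := by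
      have h := hAAi (u θ)
      change Fr 1 (Frinv 0 (Ai 1 (u θ))) = u θ at h
      calc Frinv 0 (Ai 1 (u θ)) = Frinv 1 (Fr 1 (Frinv 0 (Ai 1 (u θ)))) := (hli 1 _).symm
        _ = Frinv 1 (u θ) := by rw [h]
    rw [hz, ← hW1 0, zero_add]
  · -- `L₂ (0, θ) = L₁ (0, -θ)`: `Ai 0` is the flip, which reverses the circle `u`
    change W (0, r • Frinv 0 (Ai 0 (u θ))) = W (0, r • Frinv 0 (u (-θ)))
    have hflip : Ai 0 (u θ) = u (-θ) := by
      simp only [hudef, map_add, map_smul, hAib₁, hAib₂, mul_neg, Real.cos_neg, Real.sin_neg,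
        neg_smul, smul_neg]
    rw [hflip]
  · -- the curves of `L₁` lie on the torus side
    change 0 < g (s, r • Frinv s (u θ))
    rw [hgper, hFrinvper s, hufr θ]
    exact hpos _ (Or.inl ⟨(toIcoMod two_pos 0 s, Int.fract θ), ⟨hmod s, hfrI θ⟩, rfl⟩) r hr hrr
  · -- the curves of `L₂` lie on the torus side
    change 0 < g (0, r • Frinv 0 (Ai s (u θ)))
    obtain ⟨s', hs', hAs⟩ := hclamp s
    rw [hAs, hufr θ]
    exact hpos _ (Or.inr ⟨(s', Int.fract θ), ⟨hs', hfrI θ⟩, rfl⟩) r hr hrr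
  · -- the formula for `L₁ (0, ·)`
    change W (0, r • Frinv 0 (u θ)) = ν₀.toFun (circlePt 0, r • (Real.cos (2 * Real.pi * θ) •
      Frinv 0 b₁ + Real.sin (2 * Real.pi * θ) • Frinv 0 b₂))
    simp only [hWdef, hudef, map_add, map_smul]

end Summit.SmoothPoincare4.SmoothPoincare4.Cruxes.RungOne.Sketch

end
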